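import Summits.QuantumFields.YangMills.Theorems.BalabanUVNodesN11NoExpansionZetaSpec

/-!
# DAG node N11 — THE POSITIVE HALF OF (S1ᵀ)₁₃ ONE LEVEL UP, FOR ANY 𝐓-WEIGHT FAMILY: at a new sequence of length `k+1` WITHOUT new small-field region,
# the (3.25) identity `slotT_{k+1}(s′) = 𝐓_{k+1}(s′)e^{A_{k+1}(s′)}` HOLDS `dV′`-a.e. as soon as (i) `ρ_k`'s slot at `init s′` has its §2 identity, (ii) the OLD
# FACTORS AGREE (the old branches of the new operand are a constant multiple of the old branches of the old operand — print's (3.24)), and (iii) the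
# generation-`k` weight factor `ζ_k(T)·w_k(∅,∅,∅)` read on the scale-`k` averaging graph IS def-T's level-`k` resummed step weight `w(s′)(U, Ū)` up to the
# reciprocal constant — the generation-`k` ζ-SPEC

Cell `pub-ymgap`, YM-PLAN Track A (HUMAN RULING D-0062), seat `pub-ymgap-dag-n11-d` (g7; R134 fan-out seat N11 [B14], strategy s2), route `BalabanUVNodes`
rev 21, item K1⁵ `StabilityBAtRecordR13SepCoP` = stmt-QuantumFields-20294 (helper, count-neutral).  [III] = [Balaban1988Convergent].
Sequel of `BalabanUVNodesN11NoExpansionZetaSpec` (p522000: the level-1 case) over g3's generic `Node00.TkNoExpansionStepSucc` (p485389: `𝐓_{k+1}(s′)` at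
`Ω_{k+1}(s′) = ∅` as a sum over the old index of one-step transports of `ζ_k(T)·w_k(∅,∅,∅)·[𝐓_k(init s′,S)Φ_S]`; `transportK_congr_ae_family`).

WHY THIS FILE.  N11's residue (S1ᵀ) at a witness is «`∀ k < K, SLaw k → TLaw k`»: at level `k` one may ASSUME the §2 form of `ρ_k` (all of `SLaw k`) and must
produce the 𝐓-image form at every new sequence `s′` of length `k+1`.  At the sequences with `Ω_{k+1}(s′) = ∅` print performs no expansion ((2.22) p. 258) and
the identity is bookkeeping: `slotT_{k+1}(s′) = T_k[w(s′)·χ_k(init s′)·slot_k(init s′)]` (def-T), `slot_k(init s′) = 𝐓_k(init s′)e^{A_k}` a.e. (`SLaw k`), and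
`𝐓_{k+1}(s′)e^{A_{k+1}} = Σ_S T_k[ζ_k(T)w_k(∅,∅,∅)·𝐓_k(init s′,S)e^{A_{k+1}}_S]` (g3) — so the identity holds as soon as «the old factors agree»
(`𝐓_k(init s′,S)e^{A_{k+1}}_S = κ·𝐓_k(init s′,S)e^{A_k}_S`, (3.24) — a DISPLAYED hypothesis here: it is a statement about the old generations' weights
reading only the scales they integrate and about the two operands, discharged per record in a sequel) AND the generation-`k` factor meets the SPEC
`ζ_k(T)·w_k(∅,∅,∅) (U, Ū) = c·w(s′)(U, Ū)` with `c·κ = 1`.  This is the level-(k+1) twin of the sibling file's level-1 theorem, GENERIC in the weight family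
`W`, the two background maps and the two term-value witnesses, so that the v1.5 `CoP` record and K0a's residual pins instantiate it.

WHAT THIS FILE PROVES (0 `sorry`, 0 `def`, standard axioms; `N`-generic; `θ : Stage13Params F N`, run `p`, `k < K`).  §1 `noExpIntegrandAt_eq_zetaFactor_mul`
(the top-generation integrand factored); `integrable_section_of_measurable_bounded` (a bounded jointly measurable integrand has integrable sections against the
averaging kernel — a probability measure); `transportOfRecord_finset_sum` (def-T's transport is additive over finite sums of kernel-integrable integrands).
§2 ★ `slotsT_succ_ae_eq_sect2Slot_of_zetaSpecAt` (THE THEOREM: hypotheses (i) the §2 identity at `init s′` — a.e. on the `χ_k`-support —, `χ_k(init s′) ≡ 1`,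
(ii) old-factor agreement with constant `κ`, (iii) the generation-`k` spec with constant `c`, `c·κ = 1`, and the displayed joint measurability ∕ bound of the
new integrand per old branch ⇒ `slotT_{k+1}(s′) = 𝐓_{k+1}(s′)e^{A_{k+1}(s′)}` a.e. on the `χ_{k+1}(s′)`-support); `hasSect2FormAtZ_clause_succ_of_zetaSpecAt` (the
dichotomy clause).

HONEST FRAMING.  Count-neutral kernel bookkeeping on the tree's OWN objects; a SUFFICIENT condition at ONE no-expansion new sequence one level up, modulo
the displayed old-factor agreement (print's (3.24); NOT proved here for any record) — NOT `TLaw k` (sequences with `Ω_{k+1}(s′) ≠ ∅` are [III] §3 + Thm 2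
proper), NOT a witness.  Nothing of Bałaban's asserted; N11 NOT discharged; counts unmoved (typed 28∕28 · discharged 5∕28).  One finite four-torus programme
at fixed `ε = L^{−K}`; NOT ℝ⁴, NOT OS, NOT a mass gap, NOT Clay.  Sources: [III] (2.18) p. 257, (2.20)–(2.23) p. 258, (3.1) p. 264, (3.16) p. 268, (3.24)–(3.25)
p. 270, Theorem p. 245, Thm 1 p. 262; [Balaban1985Averaging] (10) p. 19.
-/

noncomputable section

open MeasureTheory
open scoped BigOperators Matrix.Norms.L2Operator

namespace Summit.QuantumFields.YangMills.Theorems.BalabanUVNodesN11NoExpansionZetaSpecSucc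

open Literature.MathematicalPhysics.QuantumFieldTheory.Balaban1983to89 T4Continuum Node00 Node00.Tk DagBinding
open B15DeterminingSets

variable {F : T4Family} {N : ℕ} [NeZero N]

/-! ## §1. The top-generation integrand factored; kernel-integrable sections; additivity of def-T's transport -/

section Tools

variable (p : B12.RunParams)

omit [NeZero N] in
/-- **THE TOP-GENERATION NO-EXPANSION INTEGRAND OF ANY WEIGHT FAMILY, FACTORED**: `(ζ_k(T)·w_k(∅,∅,∅))(ω)·Ψ(ω)` at the two-scale configuration
`ω = (V_k, V_{k+1}) = (U, V′)`. [cite: Balaban1988Convergent, (2.21)–(2.22) p.258, (3.24) p.270] -/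
theorem noExpIntegrandAt_eq_zetaFactor_mul (k : ℕ) (W : TkWeights F N (FluctV N) p.K) (Ψ : MultiCfg (F.P p.K) (SU N) (FluctV N) → ℝ)
    (V' : GaugeField (F.P p.K) (k + 1) (SU N)) (U : GaugeField (F.P p.K) k (SU N)) :
    noExpIntegrandAt F N (FluctV N) p.K k W Ψ V' U =
      (W.ζ k Set.univ (pairCfgAt (V := FluctV N) k V' U) * W.w k ∅ ∅ ∅ (pairCfgAt (V := FluctV N) k V' U)) *
        Ψ (pairCfgAt (V := FluctV N) k V' U) := by
  unfold noExpIntegrandAt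
  rw [mul_assoc]

/-- **A BOUNDED, JOINTLY MEASURABLE INTEGRAND FAMILY HAS KERNEL-INTEGRABLE SECTIONS**: for every coarse field `V′` the section `U ↦ f(V′, U)` is
integrable against the averaging kernel of record at `V′` (a probability measure: the conditional law of the fine field given its average).
[cite: Balaban1985Averaging, (10) p.19 (bookkeeping)] -/
theorem integrable_section_of_measurable_bounded (k : ℕ) {f : GaugeField (F.P p.K) (k + 1) (SU N) → GaugeField (F.P p.K) k (SU N) → ℝ}
    (hm : Measurable (Function.uncurry f)) {C : ℝ} (hC : ∀ V' U, |f V' U| ≤ C) (V' : GaugeField (F.P p.K) (k + 1) (SU N)) :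
    Integrable (f V') (T4AveragingDisintegration.avgKernel (avOfRecord F N p.K k).avg V') := by
  have hsec : Measurable (f V') := hm.comp measurable_prodMk_left
  refine Integrable.of_bound hsec.aestronglyMeasurable C (Filter.Eventually.of_forall fun U => ?_)
  rw [Real.norm_eq_abs]
  exact hC V' U

/-- **def-T's TRANSPORT OF RECORD IS ADDITIVE OVER FINITE SUMS** of kernel-integrable integrands (`integral_finset_sum` inside the kernel transport).
[cite: Balaban1988Convergent, (3.1) p.264 (bookkeeping)] -/
theorem transportOfRecord_finset_sum (k : ℕ) {ι : Type*} (S : Finset ι) (f : ι → GaugeField (F.P p.K) k (SU N) → ℝ)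
    (V' : GaugeField (F.P p.K) (k + 1) (SU N))
    (hf : ∀ i ∈ S, Integrable (f i) (T4AveragingDisintegration.avgKernel (avOfRecord F N p.K k).avg V')) :
    transportOfRecord F N p.K k (fun U => ∑ i ∈ S, f i U) V' = ∑ i ∈ S, transportOfRecord F N p.K k (f i) V' := by
  show T4AveragingDisintegration.kernelTransport _ _ _ (fun U => ∑ i ∈ S, f i U) V' =
    ∑ i ∈ S, T4AveragingDisintegration.kernelTransport _ _ _ (f i) V'
  simp only [T4AveragingDisintegration.kernelTransport]
  rw [integral_finsetSum S hf, Finset.mul_sum]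

end Tools

/-! ## §2. THE THEOREM: the (3.25) identity one level up from the §2 identity at `init s′`, old-factor agreement and the generation-`k` ζ-spec -/

section Positive

variable (θ : Stage13Params F N) (p : B12.RunParams)

/-- **★ THE (S1ᵀ)₁₃ IDENTITY AT A NO-EXPANSION NEW SEQUENCE OF LENGTH `k+1`, UNDER OLD-FACTOR AGREEMENT AND THE GENERATION-`k` ζ-SPEC — ANY WEIGHT FAMILY.**
Let `s′` have `Ω_{k+1}(s′) = ∅` (`k < K`), `W` any 𝐓-weight family, `(t, E_k, U_k)` a §2 witness of `ρ_k`'s slot at `init s′` (identity a.e. on the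
`χ_k`-support) with `χ_k(init s′) ≡ 1`, and `(t′, E_{k+1}, U_{k+1})` the proposed witness at `s′`.  Suppose (ii) OLD-FACTOR AGREEMENT: for every old branch `S`,
`𝐓_k(init s′,S)[e^{A_{k+1}(s′)}]_S (U, V′) = κ·𝐓_k(init s′,S)[e^{A_k(init s′)}]_S (U)` (the old generations read only the scales they integrate and the two
operands differ by the constant `κ`); (iii) THE GENERATION-`k` SPEC on the averaging graph: `ζ_k(T)(U,Ū)·w_k(∅,∅,∅)(U,Ū) = c·w(s′)(U,Ū)` with `c·κ = 1`;
and the displayed joint measurability ∕ bound of the new integrand per old branch.  Then `slotT_{k+1}(s′)(V′) = 𝐓_{k+1}(s′)e^{A_{k+1}(s′)}(V′)` for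
`dV′`-a.e. `V′` on the `χ_{k+1}(s′)`-support.  Proof: def-T's slot is `T_k[w(s′)·χ_k·slot_k(init s′)]` =ᵐ `T_k[w(s′)·Σ_S 𝐓_k(init s′,S)e^{A_k}_S]`
(`SLaw`'s identity through `transportK_congr_ae_family`); 11a's slot is =ᵐ `Σ_S T_k[ζ_k w_k·𝐓_k(init s′,S)e^{A_{k+1}}_S]` (g3) `= T_k[Σ_S …]` (additivity);
the two integrands AGREE ON THE GRAPH `V′ = Ū` by (ii)–(iii), so g3's `transportK_congr_ae_of_fibre` closes.
[cite: Balaban1988Convergent, Theorem p.245, (3.24)–(3.25) p.270, (2.18) p.257, (2.20)–(2.22) p.258, (3.1) p.264, (3.16) p.268] -/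
theorem slotsT_succ_ae_eq_sect2Slot_of_zetaSpecAt {k : ℕ} (hk : k < p.K)
    (s : SeqOfRecord F θ.ν θ.τ9.M (gOfRecord₁₃ F N θ p) p.K (k + 1)) (hΩ : s.Ω (k + 1) = ∅) (W : TkWeights F N (FluctV N) p.K)
    (t : Sect2.TermValues (F.P p.K) (MatA N) (FluctV N) θ.τ9.M) (Ek : ℝ) (U : BgMap F N p.K)
    (hid : ∀ᵐ U₀ ∂fieldMeasure (F.P p.K) k (SU N),
      chiSeqOfRecord F N θ.ν θ.τ9.M (gOfRecord₁₃ F N θ p) p.K k s.init U₀ ≠ 0 →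
        slotsOfRecord F N θ.ν θ.τ9 (EOfRecord₁₃ F N θ) (wOfRecord₉ F N θ.toStage9Params) θ.ppSel p
            (gOfRecord₁₃ F N θ p) k s.init U₀ =
          sect2Slot F N (FluctV N) p.K (settingOfRecord₁₃ F N θ p) (θ.Rz p.K) W s.init t Ek U U₀)
    (hχ : ∀ U₀ : GaugeField (F.P p.K) k (SU N), chiSeqOfRecord F N θ.ν θ.τ9.M (gOfRecord₁₃ F N θ p) p.K k s.init U₀ = 1)
    (t' : Sect2.TermValues (F.P p.K) (MatA N) (FluctV N) θ.τ9.M) (Ek' : ℝ) (U' : BgMap F N p.K)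
    {κ c C : ℝ} (hcκ : c * κ = 1)
    (hbranch : ∀ S ∈ admSOfRecord F θ.ν θ.τ9.M (gOfRecord₁₃ F N θ p) p.K k s.init,
      ∀ (V' : GaugeField (F.P p.K) (k + 1) (SU N)) (U₀ : GaugeField (F.P p.K) k (SU N)),
        tkBranchOfRecord F N (FluctV N) θ.ν θ.τ9.M _ p.K W s.init S k
            (fun ω => sect2Operand F N (FluctV N) p.K (settingOfRecord₁₃ F N θ p) (θ.Rz p.K) s t' Ek' U' (S, fun j => (ω j).2) (fun j => (ω j).1))
            (pairCfgAt (V := FluctV N) k V' U₀) =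
          κ * tkBranchOfRecord F N (FluctV N) θ.ν θ.τ9.M _ p.K W s.init S k
            (fun ω => sect2Operand F N (FluctV N) p.K (settingOfRecord₁₃ F N θ p) (θ.Rz p.K) s.init t Ek U (S, fun j => (ω j).2) (fun j => (ω j).1))
            (baseCfg k U₀))
    (hζ : ∀ U₀ : GaugeField (F.P p.K) k (SU N),
      W.ζ k Set.univ (pairCfgAt (V := FluctV N) k ((avOfRecord F N p.K k).avg U₀) U₀) *
          W.w k ∅ ∅ ∅ (pairCfgAt (V := FluctV N) k ((avOfRecord F N p.K k).avg U₀) U₀) =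
        c * wOfRecord₉ F N θ.toStage9Params p (gOfRecord₁₃ F N θ p) k s U₀ ((avOfRecord F N p.K k).avg U₀))
    (hm : ∀ S ∈ admSOfRecord F θ.ν θ.τ9.M (gOfRecord₁₃ F N θ p) p.K k s.init,
      Measurable (Function.uncurry (noExpIntegrandAt F N (FluctV N) p.K k W
        (tkBranchOfRecord F N (FluctV N) θ.ν θ.τ9.M _ p.K W s.init S k
          (fun ω => sect2Operand F N (FluctV N) p.K (settingOfRecord₁₃ F N θ p) (θ.Rz p.K) s t' Ek' U' (S, fun j => (ω j).2) (fun j => (ω j).1))))))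
    (hC : ∀ S ∈ admSOfRecord F θ.ν θ.τ9.M (gOfRecord₁₃ F N θ p) p.K k s.init, ∀ V' U₀,
      |noExpIntegrandAt F N (FluctV N) p.K k W
        (tkBranchOfRecord F N (FluctV N) θ.ν θ.τ9.M _ p.K W s.init S k
          (fun ω => sect2Operand F N (FluctV N) p.K (settingOfRecord₁₃ F N θ p) (θ.Rz p.K) s t' Ek' U' (S, fun j => (ω j).2) (fun j => (ω j).1)))
        V' U₀| ≤ C) :
    ∀ᵐ V' ∂fieldMeasure (F.P p.K) (k + 1) (SU N),
      chiSeqOfRecord F N θ.ν θ.τ9.M (gOfRecord₁₃ F N θ p) p.K (k + 1) s V' ≠ 0 →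
        slotsTOfRecord F N θ.ν θ.τ9 (EOfRecord₁₃ F N θ) (wOfRecord₉ F N θ.toStage9Params) θ.ppSel p
            (gOfRecord₁₃ F N θ p) (k + 1) s V' =
          sect2Slot F N (FluctV N) p.K (settingOfRecord₁₃ F N θ p) (θ.Rz p.K) W s t' Ek' U' V' := by
  classical
  -- abbreviations: the old branches of the old operand at the base configuration, and the new integrand per old branch
  set B : (ℕ → Set (Site (F.P p.K) 0)) → GaugeField (F.P p.K) k (SU N) → ℝ := fun S U₀ =>
    tkBranchOfRecord F N (FluctV N) θ.ν θ.τ9.M _ p.K W s.init S k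
      (fun ω => sect2Operand F N (FluctV N) p.K (settingOfRecord₁₃ F N θ p) (θ.Rz p.K) s.init t Ek U (S, fun j => (ω j).2) (fun j => (ω j).1))
      (baseCfg k U₀) with hB
  set G : (ℕ → Set (Site (F.P p.K) 0)) → GaugeField (F.P p.K) (k + 1) (SU N) → GaugeField (F.P p.K) k (SU N) → ℝ := fun S V' U₀ =>
    noExpIntegrandAt F N (FluctV N) p.K k W
      (tkBranchOfRecord F N (FluctV N) θ.ν θ.τ9.M _ p.K W s.init S k
        (fun ω => sect2Operand F N (FluctV N) p.K (settingOfRecord₁₃ F N θ p) (θ.Rz p.K) s t' Ek' U' (S, fun j => (ω j).2) (fun j => (ω j).1)))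
      V' U₀ with hG
  set A := admSOfRecord F θ.ν θ.τ9.M (gOfRecord₁₃ F N θ p) p.K k s.init with hA
  -- (1) def-T's slot: a.e. the transport of `w(s′)·Σ_S B_S` (SLaw's identity at `init s′`, `χ_k ≡ 1`, `TkOfRecord_apply`)
  have hsect : ∀ U₀ : GaugeField (F.P p.K) k (SU N),
      sect2Slot F N (FluctV N) p.K (settingOfRecord₁₃ F N θ p) (θ.Rz p.K) W s.init t Ek U U₀ = ∑ S ∈ A, B S U₀ :=
    fun U₀ => TkOfRecord_apply F N (FluctV N) θ.ν θ.τ9.M _ p.K W k s.init _ U₀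
  have h1 := transportK_congr_ae_family (avOfRecord_measurable F N p.K k) (avOfRecord_haarAC F N p.K k hk)
    (f := fun V' U₀ => wOfRecord₉ F N θ.toStage9Params p (gOfRecord₁₃ F N θ p) k s U₀ V' *
      (chiSeqOfRecord F N θ.ν θ.τ9.M (gOfRecord₁₃ F N θ p) p.K k s.init U₀ *
        slotsOfRecord F N θ.ν θ.τ9 (EOfRecord₁₃ F N θ) (wOfRecord₉ F N θ.toStage9Params) θ.ppSel p (gOfRecord₁₃ F N θ p) k s.init U₀))
    (g := fun V' U₀ => wOfRecord₉ F N θ.toStage9Params p (gOfRecord₁₃ F N θ p) k s U₀ V' * ∑ S ∈ A, B S U₀)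
    (hid.mono fun U₀ hU V' => by
      have hne : chiSeqOfRecord F N θ.ν θ.τ9.M (gOfRecord₁₃ F N θ p) p.K k s.init U₀ ≠ 0 := by rw [hχ U₀]; exact one_ne_zero
      rw [hU hne, hχ U₀, one_mul, hsect U₀])
  -- (2) 11a's slot: a.e. the sum over the old index of the transports of the new integrands (g3), = the transport of their sum (additivity)
  have h2 := TkOfRecord_succ_ae_eq_sum_transportOfRecord_of_Omega_empty θ.ν θ.τ9.M _ p.K W hk s hΩ
    (sect2Operand F N (FluctV N) p.K (settingOfRecord₁₃ F N θ p) (θ.Rz p.K) s t' Ek' U') hm hC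
  have hsum : ∀ V' : GaugeField (F.P p.K) (k + 1) (SU N),
      ∑ S ∈ A, transportOfRecord F N p.K k (G S V') V' = transportOfRecord F N p.K k (fun U₀ => ∑ S ∈ A, G S V' U₀) V' := fun V' =>
    (transportOfRecord_finset_sum p k A (fun S => G S V') V'
      (fun S hS => integrable_section_of_measurable_bounded p k (hm S hS) (hC S hS) V')).symm
  -- (3) the two integrand families AGREE ON THE GRAPH `V′ = Ū`: old-factor agreement, the spec, `c·κ = 1`
  have hfib : ∀ U₀ : GaugeField (F.P p.K) k (SU N),
      wOfRecord₉ F N θ.toStage9Params p (gOfRecord₁₃ F N θ p) k s U₀ ((avOfRecord F N p.K k).avg U₀) * ∑ S ∈ A, B S U₀ =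
        ∑ S ∈ A, G S ((avOfRecord F N p.K k).avg U₀) U₀ := by
    intro U₀
    rw [Finset.mul_sum]
    refine Finset.sum_congr rfl fun S hS => ?_
    simp only [hG, hB]
    rw [noExpIntegrandAt_eq_zetaFactor_mul, hζ U₀, hbranch S hS]
    calc wOfRecord₉ F N θ.toStage9Params p (gOfRecord₁₃ F N θ p) k s U₀ ((avOfRecord F N p.K k).avg U₀) *
          tkBranchOfRecord F N (FluctV N) θ.ν θ.τ9.M _ p.K W s.init S k
            (fun ω => sect2Operand F N (FluctV N) p.K (settingOfRecord₁₃ F N θ p) (θ.Rz p.K) s.init t Ek U (S, fun j => (ω j).2)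
              (fun j => (ω j).1)) (baseCfg k U₀)
        = (c * κ) * (wOfRecord₉ F N θ.toStage9Params p (gOfRecord₁₃ F N θ p) k s U₀ ((avOfRecord F N p.K k).avg U₀) *
          tkBranchOfRecord F N (FluctV N) θ.ν θ.τ9.M _ p.K W s.init S k
            (fun ω => sect2Operand F N (FluctV N) p.K (settingOfRecord₁₃ F N θ p) (θ.Rz p.K) s.init t Ek U (S, fun j => (ω j).2)
              (fun j => (ω j).1)) (baseCfg k U₀)) := by rw [hcκ, one_mul]
      _ = c * wOfRecord₉ F N θ.toStage9Params p (gOfRecord₁₃ F N θ p) k s U₀ ((avOfRecord F N p.K k).avg U₀) *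
          (κ * tkBranchOfRecord F N (FluctV N) θ.ν θ.τ9.M _ p.K W s.init S k
            (fun ω => sect2Operand F N (FluctV N) p.K (settingOfRecord₁₃ F N θ p) (θ.Rz p.K) s.init t Ek U (S, fun j => (ω j).2)
              (fun j => (ω j).1)) (baseCfg k U₀)) := by ring
  have h3 := transportK_congr_ae_of_fibre (avOfRecord_measurable F N p.K k) (avOfRecord_haarAC F N p.K k hk)
    (f := fun V' U₀ => wOfRecord₉ F N θ.toStage9Params p (gOfRecord₁₃ F N θ p) k s U₀ V' * ∑ S ∈ A, B S U₀)
    (g := fun V' U₀ => ∑ S ∈ A, G S V' U₀) hfib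
  -- (4) assemble
  filter_upwards [h1, h2, h3] with V' e1 e2 e3 _
  rw [slotsTOfRecord_succ_apply]
  show T4AveragingDisintegration.transportK (avOfRecord F N p.K k).avg _ V' = _
  rw [e1, e3]
  show transportOfRecord F N p.K k (fun U₀ => ∑ S ∈ A, G S V' U₀) V' = _
  rw [← hsum V']
  exact e2.symm

/-- **… HENCE THE DICHOTOMY CLAUSE OF `HasSect2FormAtZ` AT `s′` ONE LEVEL UP** (identity branch), under the same hypotheses.
[cite: Balaban1988Convergent, (2.17)–(2.18) p.257, (3.25) p.270] -/
theorem hasSect2FormAtZ_clause_succ_of_zetaSpecAt {k : ℕ} (hk : k < p.K)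
    (s : SeqOfRecord F θ.ν θ.τ9.M (gOfRecord₁₃ F N θ p) p.K (k + 1)) (hΩ : s.Ω (k + 1) = ∅) (W : TkWeights F N (FluctV N) p.K)
    (t : Sect2.TermValues (F.P p.K) (MatA N) (FluctV N) θ.τ9.M) (Ek : ℝ) (U : BgMap F N p.K)
    (hid : ∀ᵐ U₀ ∂fieldMeasure (F.P p.K) k (SU N),
      chiSeqOfRecord F N θ.ν θ.τ9.M (gOfRecord₁₃ F N θ p) p.K k s.init U₀ ≠ 0 →
        slotsOfRecord F N θ.ν θ.τ9 (EOfRecord₁₃ F N θ) (wOfRecord₉ F N θ.toStage9Params) θ.ppSel p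
            (gOfRecord₁₃ F N θ p) k s.init U₀ =
          sect2Slot F N (FluctV N) p.K (settingOfRecord₁₃ F N θ p) (θ.Rz p.K) W s.init t Ek U U₀)
    (hχ : ∀ U₀ : GaugeField (F.P p.K) k (SU N), chiSeqOfRecord F N θ.ν θ.τ9.M (gOfRecord₁₃ F N θ p) p.K k s.init U₀ = 1)
    (t' : Sect2.TermValues (F.P p.K) (MatA N) (FluctV N) θ.τ9.M) (Ek' : ℝ) (U' : BgMap F N p.K)
    {κ c C : ℝ} (hcκ : c * κ = 1)
    (hbranch : ∀ S ∈ admSOfRecord F θ.ν θ.τ9.M (gOfRecord₁₃ F N θ p) p.K k s.init,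
      ∀ (V' : GaugeField (F.P p.K) (k + 1) (SU N)) (U₀ : GaugeField (F.P p.K) k (SU N)),
        tkBranchOfRecord F N (FluctV N) θ.ν θ.τ9.M _ p.K W s.init S k
            (fun ω => sect2Operand F N (FluctV N) p.K (settingOfRecord₁₃ F N θ p) (θ.Rz p.K) s t' Ek' U' (S, fun j => (ω j).2) (fun j => (ω j).1))
            (pairCfgAt (V := FluctV N) k V' U₀) =
          κ * tkBranchOfRecord F N (FluctV N) θ.ν θ.τ9.M _ p.K W s.init S k
            (fun ω => sect2Operand F N (FluctV N) p.K (settingOfRecord₁₃ F N θ p) (θ.Rz p.K) s.init t Ek U (S, fun j => (ω j).2) (fun j => (ω j).1))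
            (baseCfg k U₀))
    (hζ : ∀ U₀ : GaugeField (F.P p.K) k (SU N),
      W.ζ k Set.univ (pairCfgAt (V := FluctV N) k ((avOfRecord F N p.K k).avg U₀) U₀) *
          W.w k ∅ ∅ ∅ (pairCfgAt (V := FluctV N) k ((avOfRecord F N p.K k).avg U₀) U₀) =
        c * wOfRecord₉ F N θ.toStage9Params p (gOfRecord₁₃ F N θ p) k s U₀ ((avOfRecord F N p.K k).avg U₀))
    (hm : ∀ S ∈ admSOfRecord F θ.ν θ.τ9.M (gOfRecord₁₃ F N θ p) p.K k s.init,
      Measurable (Function.uncurry (noExpIntegrandAt F N (FluctV N) p.K k W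
        (tkBranchOfRecord F N (FluctV N) θ.ν θ.τ9.M _ p.K W s.init S k
          (fun ω => sect2Operand F N (FluctV N) p.K (settingOfRecord₁₃ F N θ p) (θ.Rz p.K) s t' Ek' U' (S, fun j => (ω j).2) (fun j => (ω j).1))))))
    (hC : ∀ S ∈ admSOfRecord F θ.ν θ.τ9.M (gOfRecord₁₃ F N θ p) p.K k s.init, ∀ V' U₀,
      |noExpIntegrandAt F N (FluctV N) p.K k W
        (tkBranchOfRecord F N (FluctV N) θ.ν θ.τ9.M _ p.K W s.init S k
          (fun ω => sect2Operand F N (FluctV N) p.K (settingOfRecord₁₃ F N θ p) (θ.Rz p.K) s t' Ek' U' (S, fun j => (ω j).2) (fun j => (ω j).1)))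
        V' U₀| ≤ C) :
    slotsTOfRecord F N θ.ν θ.τ9 (EOfRecord₁₃ F N θ) (wOfRecord₉ F N θ.toStage9Params) θ.ppSel p (gOfRecord₁₃ F N θ p) (k + 1) s = 0 ∨
      ∀ᵐ V' ∂fieldMeasure (F.P p.K) (k + 1) (SU N),
        chiSeqOfRecord F N θ.ν θ.τ9.M (gOfRecord₁₃ F N θ p) p.K (k + 1) s V' ≠ 0 →
          slotsTOfRecord F N θ.ν θ.τ9 (EOfRecord₁₃ F N θ) (wOfRecord₉ F N θ.toStage9Params) θ.ppSel p
              (gOfRecord₁₃ F N θ p) (k + 1) s V' =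
            sect2Slot F N (FluctV N) p.K (settingOfRecord₁₃ F N θ p) (θ.Rz p.K) W s t' Ek' U' V' :=
  Or.inr (slotsT_succ_ae_eq_sect2Slot_of_zetaSpecAt θ p hk s hΩ W t Ek U hid hχ t' Ek' U' hcκ hbranch hζ hm hC)

end Positive

end Summit.QuantumFields.YangMills.Theorems.BalabanUVNodesN11NoExpansionZetaSpecSucc

end
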